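import Summits.RiemannHypothesis.RiemannHypothesis.Theorems.GroundBartaEvenWinsBeyondArchPhantomCertificate
import Literature.NumberTheory.LFunctions.WeilTwoPrimeCellsT80NuSplit
import HarnessLib

/-!
# RiemannHypothesis / GroundBarta machinery — one entry of the moment check of a phantom certificate (`WeilCert23X`) on the T80 chain from
the landed chunk facts, a phantom-cell moment fact and a literal inequality

Helper file (`--supports stmt-RiemannHypothesis-18085 --as helper`), RH-free; seat rh-explicit-weil-6 (calibration certificate M80X, memo
`run/shared/lean/pub/rh-explicit/WEIL6-APRIME.md` §1.1).  The `WeilCert23X` twin of `WeilCert23.checkNuAt_of_partsT80`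
(`WeilTwoPrimeCellsT80NuSplit.lean`): for a certificate whose two-prime cells are `weilTwoPrimeCellsT80` at the level `weilTwoPrimeCellsT80Level` and
whose cut-off is `T = 80`, `checkNuAt q` follows from the four materialized chunk sums (`nuPartT80_{i}_{q}_eq`, tree), the exact phantom-cell moment
`xCellsMomentQ xcells q`, and `|ν̃_q − nuScale · a₀^q · 2 (v₀+v₁+v₂+v₃ + (wL − wL₀) 80^{q+1}/(q+1) − v_X)| ≤ 2^{-pnu}` between literals. Pure bookkeeping; proved.
-/

set_option linter.dupNamespace false

noncomputable section

namespace Summit.RiemannHypothesis.RiemannHypothesis.Theorems.EvenWinsBeyondArch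

open Literature.NumberTheory.LFunctions

/-- **One entry of the moment check of a `WeilCert23X` on the T80 chain from parts.** [folklore] -/
theorem WeilCert23X.checkNuAt_of_partsT80 (c : WeilCert23X) (hcells : c.cells = weilTwoPrimeCellsT80)
    (hwl : c.base.wL = weilTwoPrimeCellsT80Level) (hT : c.base.T = 80) {X : List XTCell} (hx : c.xcells = X) (q : ℕ)
    {v₀ v₁ v₂ v₃ vx : ℚ}
    (h₀ : cellsMomentQ₂₃ weilTwoPrimeCellsT80Level weilTwoPrimeCellsT80C0 q = v₀)
    (h₁ : cellsMomentQ₂₃ weilTwoPrimeCellsT80Level (weilTwoPrimeCellsT80C1.take 53) q = v₁)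
    (h₂ : cellsMomentQ₂₃ weilTwoPrimeCellsT80Level (weilTwoPrimeCellsT80C1.drop 53) q = v₂)
    (h₃ : cellsMomentQ₂₃ weilTwoPrimeCellsT80Level weilTwoPrimeCellsT80C2 q = v₃)
    (hX : xCellsMomentQ X q = vx)
    (hineq : |getV c.nuData q - nuScale * (c.base.a0 ^ q *
        (2 * (v₀ + v₁ + v₂ + v₃ + (c.wL - weilTwoPrimeCellsT80Level) * ((80 : ℚ) ^ (q + 1) / (q + 1)) - vx)))| ≤ 1 / 2 ^ c.pnu) :
    c.checkNuAt q = true := by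
  unfold WeilCert23X.checkNuAt WeilCert23X.nuQ momentX
  rw [hcells, hwl, hT, hx, cellsMomentQ₂₃_T80_split, h₀, h₁, h₂, h₃, hX]
  exact decide_eq_true hineq

end Summit.RiemannHypothesis.RiemannHypothesis.Theorems.EvenWinsBeyondArch

end
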